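import Summits.CriticalPhenomena.PercolationContinuityZ3.Theorems.PercNearOneGluingNoHeavyQuantBlockCombHairRow
import HarnessLib

/-!
# QUANT lane R8, FAR on trees beyond block-combs: the THREE-POINT SIDE LAW row (mixture principle, abstract form; cherries)

builds on p205010 (kernel theorem, internal audit signed; external expert review pending)

Support file (`--supports stmt-CriticalPhenomena-4575`), QUANT lane seat prim-quant-census-1 (gen 13); memo
`run/shared/lean/prim/quant/prim-quant-census-1/GENERAL-ROW-G13.md` §7.  Theorems only, no sorries, standard axioms; model of
`…QuantBlockCombMergeModel.lean`; tools of `…QuantBlockCombHairRow.lean` (`tail_gate_split`, `tail_sure_transfer`) and the general row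
`tail_ge_of_mean` (p247138).

* `Quant.BlockComb.tail_ge_of_mean_threePoint` — **THEOREM (block-comb + one side structure with a three-point count law).**  A side
  structure at chain level `l = lv u` whose count law (given its chain vertex is reached) is `(π₀, π₁, π₂)` on `{0,1,2}` enters the
  tree tail as `π₀·T₀ + π₁·T₁ + π₂·T₂` (`T_h` = canonical tail with a sure blob of size `h` at level `l`).  If there are 'unit gates'
  `m₁, m₂ ∈ [0,1]` above the floor (`(∏_{i<l} q)·m_i ≥ x`) with `π₁ + 2π₂ = m₁ + m₂` (mean) and `m₁m₂ ≤ π₂ ≤ (m₁+m₂)/2`, and the budget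
  `2j < Σ a·marginal + (∏_{i<l} q)·(m₁ + m₂)` holds, then `x ≤ π₀ T₀ + π₁ T₁ + π₂ T₂`.  Proof: the law is the mean-preserving mixture of
  [two independent units `m₁, m₂`] and [one block of size 2 at gate `(m₁+m₂)/2`], both block-combs closed by `tail_ge_of_mean`.
* `Quant.BlockComb.tail_ge_of_mean_cherry` — COROLLARY: a CHERRY (a non-relay vertex of gate `w` at chain level `l` with two unit relay
  children of gates `b`, `c`): law `(1 − w + w(1−b)(1−c), w(b(1−c) + c(1−b)), w b c)`, unit gates `w b`, `w c`.  Together with the hair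
  row (`…HairRow`): FAR for every tree whose side structures off the argmin chain carry at most two unit relays each (N20).
-/

namespace Summit.CriticalPhenomena.PercolationContinuityZ3.Theorems

namespace Quant

namespace BlockComb

open Finset

variable {κ : Type*} [Fintype κ] [DecidableEq κ]

/-- product-Bernoulli weight of the set `S` of open blob gates -/
local notation3 "wt[" g ", " S "]" => ∏ k, (if k ∈ (S : Finset κ) then (g : κ → ℝ) k else 1 - (g : κ → ℝ) k)

/-- the same weight with the gate of `s` removed -/
local notation3 "wt'[" g ", " s ", " S "]" =>
  ∏ k ∈ (Finset.univ : Finset κ).erase s, (if k ∈ (S : Finset κ) then (g : κ → ℝ) k else 1 - (g : κ → ℝ) k)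

/-- probability that the chain `q` of length `D` is open exactly to depth `i` -/
local notation3 "pd[" D ", " q ", " i "]" =>
  (∏ i' ∈ Finset.range (i : ℕ), (q : ℕ → ℝ) i') * (if (i : ℕ) < (D : ℕ) then 1 - (q : ℕ → ℝ) i else 1)

/-- mass counted at depth `i` in blob configuration `S` -/
local notation3 "mass[" lv ", " a ", " i ", " S "]" =>
  ∑ k ∈ (S : Finset κ).filter (fun k => (lv : κ → ℕ) k ≤ (i : ℕ)), ((a : κ → ℕ) k : ℕ)

/-- the tail `P(N ≥ j+1)` of the block-comb count, as an explicit finite sum -/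
local notation3 "TAIL[" D ", " q ", " lv ", " a ", " g ", " j "]" =>
  ∑ i ∈ Finset.range ((D : ℕ) + 1), pd[D, q, i] *
    ∑ S : Finset κ, wt[g, S] * (if (j : ℕ) + 1 ≤ mass[lv, a, i, S] then (1 : ℝ) else 0)

/-- **THEOREM (block-comb + one side structure with a three-point law, canonical form).**  See the file header. [this work] -/
theorem tail_ge_of_mean_threePoint (D : ℕ) (q : ℕ → ℝ) (hq : ∀ i, 0 ≤ q i ∧ q i ≤ 1) (lv : κ → ℕ) (a : κ → ℕ)
    (g : κ → ℝ) (hg : ∀ k, 0 ≤ g k ∧ g k ≤ 1) (j : ℕ) (hlv : ∀ k, 0 < a k → lv k ≤ D)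
    (u β : κ) (huβ : u ≠ β) (hlu : lv u ≤ D) (hlβ : lv β = lv u) (hau : a u = 0) (haβ : a β = 0)
    (π₀ π₁ π₂ m₁ m₂ : ℝ) (hm₁ : 0 ≤ m₁ ∧ m₁ ≤ 1) (hm₂ : 0 ≤ m₂ ∧ m₂ ≤ 1)
    (hmass : π₀ + π₁ + π₂ = 1) (hmean : π₁ + 2 * π₂ = m₁ + m₂) (hlow : m₁ * m₂ ≤ π₂) (hhigh : π₂ ≤ (m₁ + m₂) / 2)
    (x : ℝ) (hx0 : 0 < x) (hxq : x = ∏ i ∈ Finset.range D, q i)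
    (hmarg : ∀ k, 0 < a k → x ≤ (∏ i ∈ Finset.range (lv k), q i) * g k)
    (hfl₁ : x ≤ (∏ i ∈ Finset.range (lv u), q i) * m₁) (hfl₂ : x ≤ (∏ i ∈ Finset.range (lv u), q i) * m₂)
    (hbudget : (2 * j : ℝ) < ∑ k, (a k : ℝ) * ((∏ i ∈ Finset.range (lv k), q i) * g k) +
      (∏ i ∈ Finset.range (lv u), q i) * (m₁ + m₂)) :
    x ≤ π₀ * TAIL[D, q, lv, a, Function.update g u 1, j] +
        π₁ * TAIL[D, q, lv, Function.update a u 1, Function.update g u 1, j] +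
        π₂ * TAIL[D, q, lv, Function.update a u 2, Function.update g u 1, j] := by
  -- abbreviations
  set P : ℝ := ∏ i ∈ Finset.range (lv u), q i with hP
  have hP01 : 0 ≤ P ∧ P ≤ 1 := prefixProd_mem q hq (lv u)
  set T0 : ℝ := TAIL[D, q, lv, a, Function.update g u 1, j] with hT0
  set T1 : ℝ := TAIL[D, q, lv, Function.update a u 1, Function.update g u 1, j] with hT1
  set T2 : ℝ := TAIL[D, q, lv, Function.update a u 2, Function.update g u 1, j] with hT2
  have hT0' : TAIL[D, q, lv, a, g, j] = T0 := by rw [hT0, tail_update_dead D q lv a g j u 1 hau]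
  -- useful function identities
  have hβu : β ≠ u := huβ.symm
  -- ### component B: one block of size 2 and gate `g₂ = (m₁+m₂)/2` at level `lv u`
  set g₂ : ℝ := (m₁ + m₂) / 2 with hg₂
  have hg₂01 : 0 ≤ g₂ ∧ g₂ ≤ 1 := by
    refine ⟨by rw [hg₂]; linarith [hm₁.1, hm₂.1], ?_⟩
    rw [hg₂]; linarith [hm₁.2, hm₂.2]
  have hPfl : x ≤ P * g₂ := by
    rw [hg₂]
    have : P * ((m₁ + m₂) / 2) = (P * m₁ + P * m₂) / 2 := by ring
    rw [this]; linarith [hfl₁, hfl₂]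
  set aB : κ → ℕ := Function.update a u 2 with haB
  set gB : κ → ℝ := Function.update g u g₂ with hgB
  have hgB01 : ∀ k, 0 ≤ gB k ∧ gB k ≤ 1 := by
    intro k; by_cases hk : k = u
    · subst hk; rw [hgB, Function.update_self]; exact hg₂01
    · rw [hgB, Function.update_of_ne hk]; exact hg k
  have hliveB : ∀ k, 0 < aB k → k = u ∨ 0 < a k := by
    intro k hk; by_cases hku : k = u
    · exact Or.inl hku
    · rw [haB, Function.update_of_ne hku] at hk; exact Or.inr hk
  have hlvB : ∀ k, 0 < aB k → lv k ≤ D := by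
    intro k hk; rcases hliveB k hk with rfl | h
    · exact hlu
    · exact hlv k h
  have hmargB : ∀ k, 0 < aB k → x ≤ (∏ i ∈ Finset.range (lv k), q i) * gB k := by
    intro k hk; rcases hliveB k hk with rfl | h
    · rw [hgB, Function.update_self]
      exact hPfl
    · by_cases hku : k = u
      · subst hku; rw [hau] at h; exact absurd h (lt_irrefl 0)
      · rw [hgB, Function.update_of_ne hku]; exact hmarg k h
  have hmeanB : ∑ k, (aB k : ℝ) * ((∏ i ∈ Finset.range (lv k), q i) * gB k) =
      ∑ k, (a k : ℝ) * ((∏ i ∈ Finset.range (lv k), q i) * g k) + P * (m₁ + m₂) := by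
    rw [Finset.sum_eq_add_sum_sdiff_singleton_of_mem (Finset.mem_univ u),
      Finset.sum_eq_add_sum_sdiff_singleton_of_mem (Finset.mem_univ u) (fun k => (a k : ℝ) * _)]
    have hrest : ∑ k ∈ ((Finset.univ : Finset κ) \ {u}), (aB k : ℝ) * ((∏ i ∈ Finset.range (lv k), q i) * gB k) =
        ∑ k ∈ ((Finset.univ : Finset κ) \ {u}), (a k : ℝ) * ((∏ i ∈ Finset.range (lv k), q i) * g k) := by
      refine Finset.sum_congr rfl fun k hk => ?_
      have hku : k ≠ u := fun h => by rw [Finset.mem_sdiff, Finset.mem_singleton] at hk; exact hk.2 h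
      rw [haB, hgB, Function.update_of_ne hku, Function.update_of_ne hku]
    rw [hrest, haB, hgB, Function.update_self, Function.update_self, hau, ← hP, hg₂]
    push_cast
    ring
  have hbudgetB : (2 * j : ℝ) < ∑ k, (aB k : ℝ) * ((∏ i ∈ Finset.range (lv k), q i) * gB k) := by
    rw [hmeanB]; exact hbudget
  have hfarB : x ≤ TAIL[D, q, lv, aB, gB, j] := tail_ge_of_mean D q hq lv aB gB hgB01 j hlvB x hx0 hxq hmargB hbudgetB
  -- expansion of component B: `TAIL_B = g₂·T2 + (1 − g₂)·T0`
  have heB : TAIL[D, q, lv, aB, gB, j] = g₂ * T2 + (1 - g₂) * T0 := by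
    rw [tail_gate_split D q lv aB gB j u]
    have h1 : gB u = g₂ := by rw [hgB, Function.update_self]
    have h2 : Function.update gB u 1 = Function.update g u 1 := by rw [hgB, Function.update_idem]
    have h3 : Function.update aB u 0 = a := by rw [haB, Function.update_idem]; exact Function.update_eq_self_iff.2 hau.symm
    rw [h1, h2, h3, hgB, tail_update_dead D q lv a g j u g₂ hau, hT0']
  -- ### component U: two independent units of gates `m₁` and `m₂` at level `lv u`
  set aU : κ → ℕ := Function.update (Function.update a u 1) β 1 with haU
  set gU : κ → ℝ := Function.update (Function.update g u m₁) β m₂ with hgU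
  have hgU01 : ∀ k, 0 ≤ gU k ∧ gU k ≤ 1 := by
    intro k
    by_cases hkβ : k = β
    · subst hkβ; rw [hgU, Function.update_self]; exact hm₂
    · by_cases hku : k = u
      · subst hku; rw [hgU, Function.update_of_ne hkβ, Function.update_self]; exact hm₁
      · rw [hgU, Function.update_of_ne hkβ, Function.update_of_ne hku]; exact hg k
  have hliveU : ∀ k, 0 < aU k → k = u ∨ k = β ∨ 0 < a k := by
    intro k hk
    by_cases hkβ : k = β
    · exact Or.inr (Or.inl hkβ)
    · by_cases hku : k = u
      · exact Or.inl hku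
      · rw [haU, Function.update_of_ne hkβ, Function.update_of_ne hku] at hk; exact Or.inr (Or.inr hk)
  have hlvU : ∀ k, 0 < aU k → lv k ≤ D := by
    intro k hk; rcases hliveU k hk with rfl | rfl | h
    · exact hlu
    · rw [hlβ]; exact hlu
    · exact hlv k h
  have hmargU : ∀ k, 0 < aU k → x ≤ (∏ i ∈ Finset.range (lv k), q i) * gU k := by
    intro k hk; rcases hliveU k hk with rfl | rfl | h
    · rw [hgU, Function.update_of_ne huβ, Function.update_self]
      exact hfl₁
    · rw [hgU, Function.update_self, hlβ]; exact hfl₂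
    · by_cases hkβ : k = β
      · subst hkβ; rw [haβ] at h; exact absurd h (lt_irrefl 0)
      · by_cases hku : k = u
        · subst hku; rw [hau] at h; exact absurd h (lt_irrefl 0)
        · rw [hgU, Function.update_of_ne hkβ, Function.update_of_ne hku]; exact hmarg k h
  have hmeanU : ∑ k, (aU k : ℝ) * ((∏ i ∈ Finset.range (lv k), q i) * gU k) =
      ∑ k, (a k : ℝ) * ((∏ i ∈ Finset.range (lv k), q i) * g k) + P * (m₁ + m₂) := by
    have hβmem : β ∈ (Finset.univ : Finset κ) \ {u} := by
      rw [Finset.mem_sdiff, Finset.mem_singleton]; exact ⟨Finset.mem_univ _, hβu⟩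
    rw [Finset.sum_eq_add_sum_sdiff_singleton_of_mem (Finset.mem_univ u),
      Finset.sum_eq_add_sum_sdiff_singleton_of_mem hβmem,
      Finset.sum_eq_add_sum_sdiff_singleton_of_mem (Finset.mem_univ u) (fun k => (a k : ℝ) * _),
      Finset.sum_eq_add_sum_sdiff_singleton_of_mem hβmem (fun k => (a k : ℝ) * _)]
    have hrest : ∑ k ∈ (((Finset.univ : Finset κ) \ {u}) \ {β}), (aU k : ℝ) * ((∏ i ∈ Finset.range (lv k), q i) * gU k) =
        ∑ k ∈ (((Finset.univ : Finset κ) \ {u}) \ {β}), (a k : ℝ) * ((∏ i ∈ Finset.range (lv k), q i) * g k) := by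
      refine Finset.sum_congr rfl fun k hk => ?_
      rw [Finset.mem_sdiff, Finset.mem_sdiff, Finset.mem_singleton, Finset.mem_singleton] at hk
      rw [haU, hgU, Function.update_of_ne hk.2, Function.update_of_ne hk.1.2, Function.update_of_ne hk.2,
        Function.update_of_ne hk.1.2]
    rw [hrest, haU, hgU, Function.update_of_ne huβ, Function.update_self, Function.update_self,
      Function.update_of_ne huβ, Function.update_self, Function.update_self, hau, haβ, hlβ, ← hP]
    push_cast
    ring
  have hbudgetU : (2 * j : ℝ) < ∑ k, (aU k : ℝ) * ((∏ i ∈ Finset.range (lv k), q i) * gU k) := by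
    rw [hmeanU]; exact hbudget
  have hfarU : x ≤ TAIL[D, q, lv, aU, gU, j] := tail_ge_of_mean D q hq lv aU gU hgU01 j hlvU x hx0 hxq hmargU hbudgetU
  -- expansion of component U: `TAIL_U = m₂·(m₁·T2 + (1 − m₁)·T1) + (1 − m₂)·(m₁·T1 + (1 − m₁)·T0)`
  have heU : TAIL[D, q, lv, aU, gU, j] = m₂ * (m₁ * T2 + (1 - m₁) * T1) + (1 - m₂) * (m₁ * T1 + (1 - m₁) * T0) := by
    -- split at `β`
    rw [tail_gate_split D q lv aU gU j β]
    have hgUβ : gU β = m₂ := by rw [hgU, Function.update_self]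
    have hgU1 : Function.update gU β 1 = Function.update (Function.update g u m₁) β 1 := by rw [hgU, Function.update_idem]
    have haU0 : Function.update aU β 0 = Function.update a u 1 := by
      rw [haU, Function.update_idem]
      exact Function.update_eq_self_iff.2 (by rw [Function.update_of_ne hβu, haβ])
    rw [hgUβ, hgU1, haU0]
    -- the `β`-closed branch: `TAIL[a[u↦1], gU] = m₁·T1 + (1 − m₁)·T0`
    have hclosed : TAIL[D, q, lv, Function.update a u 1, gU, j] = m₁ * T1 + (1 - m₁) * T0 := by
      have hdeadβ : Function.update a u 1 β = 0 := by rw [Function.update_of_ne hβu, haβ]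
      have ha0 : Function.update a u 0 = a := Function.update_eq_self_iff.2 hau.symm
      rw [hgU, tail_update_dead D q lv (Function.update a u 1) (Function.update g u m₁) j β m₂ hdeadβ,
        tail_gate_split D q lv (Function.update a u 1) (Function.update g u m₁) j u, Function.update_self,
        Function.update_idem, Function.update_idem, ha0, tail_update_dead D q lv a g j u m₁ hau, hT0']
    -- the `β`-open branch: `TAIL[aU, g[u↦m₁][β↦1]] = m₁·T2 + (1 − m₁)·T1`
    have hopen : TAIL[D, q, lv, aU, Function.update (Function.update g u m₁) β 1, j] = m₁ * T2 + (1 - m₁) * T1 := by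
      rw [tail_gate_split D q lv aU (Function.update (Function.update g u m₁) β 1) j u]
      have hgu : Function.update (Function.update g u m₁) β 1 u = m₁ := by
        rw [Function.update_of_ne huβ, Function.update_self]
      rw [hgu]
      -- both sure: merge `β` into `u` (sizes 1 + 1 = 2), then forget the gate of the dead `β`
      have hG : Function.update (Function.update (Function.update g u m₁) β 1) u 1 =
          Function.update (Function.update g u 1) β 1 := by
        rw [Function.update_comm huβ, Function.update_idem, Function.update_comm hβu]
      have hboth : TAIL[D, q, lv, aU, Function.update (Function.update (Function.update g u m₁) β 1) u 1, j] = T2 := by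
        rw [hG, tail_sure_transfer D q lv aU (Function.update (Function.update g u 1) β 1) j u β huβ hlβ
          (by rw [Function.update_of_ne huβ, Function.update_self]) (Function.update_self ..)]
        have hsz : Function.update (Function.update aU β 0) u (aU u + aU β) = Function.update a u 2 := by
          rw [haU]
          ext k
          by_cases hku : k = u
          · subst hku
            rw [Function.update_self, Function.update_of_ne huβ, Function.update_self, Function.update_self,
              Function.update_self]
          · rw [Function.update_of_ne hku, Function.update_of_ne hku]
            by_cases hkβ : k = β
            · subst hkβ; rw [Function.update_self, haβ]
            · rw [Function.update_of_ne hkβ, Function.update_of_ne hkβ, Function.update_of_ne hku]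
        rw [hsz]
        have hdeadβ : Function.update a u 2 β = 0 := by rw [Function.update_of_ne hβu, haβ]
        rw [tail_update_dead D q lv (Function.update a u 2) (Function.update g u 1) j β 1 hdeadβ]
      -- `u` closed, `β` sure of size 1: relabel `β` as `u`
      have honly : TAIL[D, q, lv, Function.update aU u 0, Function.update (Function.update g u m₁) β 1, j] = T1 := by
        have ha1 : Function.update aU u 0 = Function.update a β 1 := by
          rw [haU]
          ext k
          by_cases hku : k = u
          · subst hku; rw [Function.update_self, Function.update_of_ne huβ, hau]
          · rw [Function.update_of_ne hku]
            by_cases hkβ : k = β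
            · subst hkβ; rw [Function.update_self, Function.update_self]
            · rw [Function.update_of_ne hkβ, Function.update_of_ne hku, Function.update_of_ne hkβ]
        rw [ha1]
        -- forget the gate of the dead `u`, make it sure instead, and transfer `β` onto `u`
        have hdeadu : Function.update a β 1 u = 0 := by rw [Function.update_of_ne huβ, hau]
        have hG' : Function.update (Function.update g u m₁) β 1 = Function.update (Function.update g β 1) u m₁ :=
          Function.update_comm huβ m₁ 1 g
        have hsz : Function.update (Function.update (Function.update a β 1) β 0) u
            (Function.update a β 1 u + Function.update a β 1 β) = Function.update a u 1 := by
          ext k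
          by_cases hku : k = u
          · subst hku; rw [Function.update_self, Function.update_self, Function.update_of_ne huβ, Function.update_self, hau]
          · rw [Function.update_of_ne hku, Function.update_of_ne hku]
            by_cases hkβ : k = β
            · subst hkβ; rw [Function.update_self, haβ]
            · rw [Function.update_of_ne hkβ, Function.update_of_ne hkβ]
        have hdeadβ : Function.update a u 1 β = 0 := by rw [Function.update_of_ne hβu, haβ]
        calc TAIL[D, q, lv, Function.update a β 1, Function.update (Function.update g u m₁) β 1, j]
            = TAIL[D, q, lv, Function.update a β 1, Function.update g β 1, j] := by
              rw [hG', tail_update_dead D q lv (Function.update a β 1) (Function.update g β 1) j u m₁ hdeadu]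
          _ = TAIL[D, q, lv, Function.update a β 1, Function.update (Function.update g β 1) u 1, j] :=
              (tail_update_dead D q lv (Function.update a β 1) (Function.update g β 1) j u 1 hdeadu).symm
          _ = TAIL[D, q, lv, Function.update a u 1, Function.update (Function.update g β 1) u 1, j] := by
              rw [tail_sure_transfer D q lv (Function.update a β 1) (Function.update (Function.update g β 1) u 1) j u β
                huβ hlβ (Function.update_self ..) (by rw [Function.update_of_ne hβu, Function.update_self]), hsz]
          _ = TAIL[D, q, lv, Function.update a u 1, Function.update (Function.update g u 1) β 1, j] := by
              rw [Function.update_comm hβu]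
          _ = T1 := by
              rw [tail_update_dead D q lv (Function.update a u 1) (Function.update g u 1) j β 1 hdeadβ]
      rw [hboth, honly]
    rw [hopen, hclosed]
  -- ### the mixture identity and the conclusion
  set TU : ℝ := TAIL[D, q, lv, aU, gU, j] with hTU
  set TB : ℝ := TAIL[D, q, lv, aB, gB, j] with hTB
  set H : ℝ := π₀ * T0 + π₁ * T1 + π₂ * T2 with hH
  have hπ₀ : π₀ = 1 - π₁ - π₂ := by linarith
  have hπ₁ : π₁ = m₁ + m₂ - 2 * π₂ := by linarith
  have key : (g₂ - m₁ * m₂) * H = (g₂ - π₂) * TU + (π₂ - m₁ * m₂) * TB := by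
    rw [hH, hπ₀, hπ₁, heU, heB, hg₂]
    ring
  have hc1 : 0 ≤ g₂ - π₂ := by rw [hg₂]; linarith
  have hc2 : 0 ≤ π₂ - m₁ * m₂ := by linarith
  rcases lt_or_eq_of_le (show m₁ * m₂ ≤ g₂ by linarith [hc1, hc2]) with hlt | heq
  · -- generic case: divide the mixture identity
    have hden : 0 < g₂ - m₁ * m₂ := sub_pos.2 hlt
    have h1 : (g₂ - π₂) * x ≤ (g₂ - π₂) * TU := mul_le_mul_of_nonneg_left hfarU hc1
    have h2 : (π₂ - m₁ * m₂) * x ≤ (π₂ - m₁ * m₂) * TB := mul_le_mul_of_nonneg_left hfarB hc2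
    have h3 : (g₂ - m₁ * m₂) * x ≤ (g₂ - m₁ * m₂) * H := by
      rw [key]
      have : (g₂ - m₁ * m₂) * x = (g₂ - π₂) * x + (π₂ - m₁ * m₂) * x := by ring
      rw [this]
      exact add_le_add h1 h2
    exact le_of_mul_le_mul_left h3 hden
  · -- degenerate case `(m₁+m₂)/2 = m₁ m₂`: then `m₁ = m₂ = 1`, `π = (0, 0, 1)`
    have hPm : 0 < P * m₂ := hx0.trans_le hfl₂
    have hm₂0 : 0 < m₂ := by
      rcases hm₂.1.lt_or_eq with h | h; · exact h
      exfalso; rw [← h, mul_zero] at hPm; exact lt_irrefl _ hPm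
    have k1 : m₁ * m₂ ≤ m₁ := mul_le_of_le_one_right hm₁.1 hm₂.2
    have k2 : m₁ * m₂ ≤ m₂ := mul_le_of_le_one_left hm₂.1 hm₁.2
    have h0 : 2 * (m₁ * m₂) = m₁ + m₂ := by rw [hg₂] at heq; linarith
    have e1 : m₁ = m₁ * m₂ := by linarith
    have e2 : m₂ = m₁ * m₂ := by linarith
    have hm12 : m₁ = m₂ := by rw [e1]; exact e2.symm
    have hm1one : m₂ = 1 := by
      have k3 : m₂ * (1 - m₂) = 0 := by
        have := e2; rw [hm12] at this; linear_combination this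
      rcases mul_eq_zero.1 k3 with h | h
      · exact absurd h hm₂0.ne'
      · linarith
    have hm₁1 : m₁ = 1 := by rw [hm12, hm1one]
    have hg₂1 : g₂ = 1 := by rw [hg₂, hm₁1, hm1one]; norm_num
    have hπ₂1 : π₂ = 1 := by
      refine le_antisymm ?_ ?_
      · have := hhigh; rw [hg₂1] at this; exact this
      · have := hlow; rw [hm₁1, hm1one] at this; linarith
    have hTB2 : TB = T2 := by rw [heB, hg₂1]; ring
    have hHT : H = T2 := by rw [hH, hπ₀, hπ₁, hπ₂1, hm₁1, hm1one]; ring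
    rw [hHT, ← hTB2]
    exact hfarB

/-- **COROLLARY (block-comb + one CHERRY, canonical form).**  A non-relay vertex of gate `w` at chain level `lv u` carrying two unit relays
of gates `b` and `c`: the cherry tail `π₀·T₀ + π₁·T₁ + π₂·T₂` with `π = (1 − w + w(1−b)(1−c), w(b(1−c)+c(1−b)), w b c)` is at least the
floor, under the budget with the cherry's mean `(∏_{i<lv u} q)·w·(b + c)` and both relay marginals above the floor. [this work] -/
theorem tail_ge_of_mean_cherry (D : ℕ) (q : ℕ → ℝ) (hq : ∀ i, 0 ≤ q i ∧ q i ≤ 1) (lv : κ → ℕ) (a : κ → ℕ)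
    (g : κ → ℝ) (hg : ∀ k, 0 ≤ g k ∧ g k ≤ 1) (j : ℕ) (hlv : ∀ k, 0 < a k → lv k ≤ D)
    (u β : κ) (huβ : u ≠ β) (hlu : lv u ≤ D) (hlβ : lv β = lv u) (hau : a u = 0) (haβ : a β = 0)
    (w b c : ℝ) (hw : 0 ≤ w ∧ w ≤ 1) (hb : 0 ≤ b ∧ b ≤ 1) (hc : 0 ≤ c ∧ c ≤ 1)
    (x : ℝ) (hx0 : 0 < x) (hxq : x = ∏ i ∈ Finset.range D, q i)
    (hmarg : ∀ k, 0 < a k → x ≤ (∏ i ∈ Finset.range (lv k), q i) * g k)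
    (hflb : x ≤ (∏ i ∈ Finset.range (lv u), q i) * (w * b)) (hflc : x ≤ (∏ i ∈ Finset.range (lv u), q i) * (w * c))
    (hbudget : (2 * j : ℝ) < ∑ k, (a k : ℝ) * ((∏ i ∈ Finset.range (lv k), q i) * g k) +
      (∏ i ∈ Finset.range (lv u), q i) * (w * b + w * c)) :
    x ≤ (1 - w + w * ((1 - b) * (1 - c))) * TAIL[D, q, lv, a, Function.update g u 1, j] +
        w * (b * (1 - c) + c * (1 - b)) * TAIL[D, q, lv, Function.update a u 1, Function.update g u 1, j] +
        w * b * c * TAIL[D, q, lv, Function.update a u 2, Function.update g u 1, j] := by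
  have hwb : 0 ≤ w * b ∧ w * b ≤ 1 := ⟨mul_nonneg hw.1 hb.1, mul_le_one₀ hw.2 hb.1 hb.2⟩
  have hwc : 0 ≤ w * c ∧ w * c ≤ 1 := ⟨mul_nonneg hw.1 hc.1, mul_le_one₀ hw.2 hc.1 hc.2⟩
  refine tail_ge_of_mean_threePoint D q hq lv a g hg j hlv u β huβ hlu hlβ hau haβ _ _ _ (w * b) (w * c) hwb hwc
    (by ring) (by ring) ?_ ?_ x hx0 hxq hmarg hflb hflc hbudget
  · -- `(wb)(wc) ≤ w b c` since `w ≤ 1`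
    have : w * b * c * (1 - w) ≥ 0 := by
      have := mul_nonneg (mul_nonneg (mul_nonneg hw.1 hb.1) hc.1) (sub_nonneg.2 hw.2); linarith
    nlinarith [this]
  · -- `w b c ≤ w (b + c)/2` since `b c ≤ (b + c)/2`
    have hbc : b * c ≤ (b + c) / 2 := by nlinarith [hb.1, hb.2, hc.1, hc.2]
    have := mul_le_mul_of_nonneg_left hbc hw.1
    nlinarith [this]

end BlockComb

end Quant

end Summit.CriticalPhenomena.PercolationContinuityZ3.Theorems
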